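import Literature.NumberTheory.DiophantineGeometry.GenEllThm21
import Literature.NumberTheory.DiophantineGeometry.GenEllProjLineInvariance
import HarnessLib

/-!
# [GenEll] Thm 2.1 (i) for `ℙ¹ ∖ {0,1,∞}` at `d = 1` is EQUIVALENT to the abc inequality

S. Mochizuki, *Arithmetic elliptic curves in general position* [cite: MochizukiGenEll2010, Thm 2.1 p.11];
Scholze–Stix 2018 §1.1 p. 1 ("a special case for the projective line `ℙ¹_ℚ` with respect to the
divisor `D = 0 + 1 + ∞` of Vojta's height inequality"). `GenEllThm21.lean` proves
`abc_of_vojtaIneq_one`: statement (i) for `(ℙ¹_ℚ, [0]+[1]+[∞])` at `d = 1` implies the displayed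
abc sentence. This file proves the CONVERSE (`vojtaIneq_one_of_abc`), hence the equivalence
`vojtaP1Deg_one_iff_abc : VojtaP1Deg 1 ↔ (∀ ε > 0, ∃ C > 0, ∀ abc triples, c < C · rad(abc)^{1+ε})`
— a faithfulness certificate for the Lean rendering of [GenEll] §1: our `U_P(Q̄)^{≤1}`, `ht`,
`log-diff`, `log-cond` make statement (i) at `d = 1` say exactly the abc inequality, neither more
nor less.

Proof of the converse. A point of `U_P(Q̄)^{≤1}` is presented over a field `F` with `[F:ℚ] = 1`,
so `F ≃ ℚ` and (presentation-independence, `GenEllProjLineInvariance.lean`) its three values are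
those of a `ℚ`-point `λ = q = n/m` (lowest terms, `q ≠ 0, 1`). For such `q` the three pairwise
coprime naturals `|n|, m, |n − m|` form an abc triple in some order (`|n| + m = |n−m|` if `n < 0`;
`|n| + |n−m| = m` if `0 < n < m`; `m + |n−m| = |n|` if `n > m`), `log-cond(q) = log rad(|n|·m·|n−m|)`
(the conductor support is the set of bad primes of `(q : 1−q : 1) = (n : m−n : m)`), `log-diff(q) = 0`
and `ht(q) = log max(|n|, m) ≤ log c` where `c` is the largest of the three. The abc inequality
`log c < log C + (1+ε) log rad` then gives `ht − (1+ε)(log-diff + log-cond) < log C` uniformly.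
-/

noncomputable section

open NumberField IsDedekindDomain Height

namespace Literature.NumberTheory.DiophantineGeometry.GenEll

/-! ## Bad primes: scaling, signs, permutations -/

section BadPrimes

variable {K : Type*} [Field K] [NumberField K]

/-- Bad primes are projective: invariant under scaling the triple by a nonzero constant. [folklore] -/
private theorem badPrimes_mul_left {c : K} (hc : c ≠ 0) (x y z : K) :
    badPrimes (c * x) (c * y) (c * z) = badPrimes x y z := by
  ext v
  have hvc : v.valuation K c ≠ 0 := (Valuation.ne_zero_iff _).mpr hc
  simp only [badPrimes, Set.mem_setOf_eq, map_mul, mul_right_inj' hvc]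

/-- Bad primes ignore the sign of the first entry. [folklore] -/
private theorem badPrimes_neg₁ (x y z : K) : badPrimes (-x) y z = badPrimes x y z := by
  ext v; simp only [badPrimes, Set.mem_setOf_eq, Valuation.map_neg]

/-- Bad primes ignore the sign of the second entry. [folklore] -/
private theorem badPrimes_neg₂ (x y z : K) : badPrimes x (-y) z = badPrimes x y z := by
  ext v; simp only [badPrimes, Set.mem_setOf_eq, Valuation.map_neg]

/-- Bad primes are symmetric in the last two entries. [folklore] -/
private theorem badPrimes_swap₂₃ (x y z : K) : badPrimes x z y = badPrimes x y z := by
  ext v; simp only [badPrimes, Set.mem_setOf_eq]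
  exact not_congr ⟨fun ⟨h1, h2⟩ => ⟨h1.trans h2, h2.symm⟩, fun ⟨h1, h2⟩ => ⟨h1.trans h2, h2.symm⟩⟩

/-- Bad primes are symmetric in the first and last entries. [folklore] -/
private theorem badPrimes_swap₁₃ (x y z : K) : badPrimes z y x = badPrimes x y z := by
  ext v; simp only [badPrimes, Set.mem_setOf_eq]
  exact not_congr ⟨fun ⟨h1, h2⟩ => ⟨h2.symm, h1.symm⟩, fun ⟨h1, h2⟩ => ⟨h2.symm, h1.symm⟩⟩

end BadPrimes

/-! ## The values at a `ℚ`-point `q = n/m` -/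

section RatValues

/-- `log-diff` vanishes and `log-cond(q) = log N_ℚ(n, m − n, m)` at the `ℚ`-point `q = n/m`
(`n = q.num`, `m = q.den`): the triple `(q : 1−q : 1)` is `m⁻¹ · (n : m−n : m)`.
[cite: MochizukiGenEll2010, Def 1.5 (iv) p.8] -/
theorem logCond_ratPoint_eq (q : ℚ) :
    (ratPoint q).logCond =
      Real.log (radicalNorm (q.num : ℚ) ((q.den : ℚ) - q.num) (q.den : ℚ)) := by
  rw [NFPoint.logCond_eq]
  change ((Module.finrank ℚ ℚ : ℕ) : ℝ)⁻¹ * Real.log (radicalNorm q (1 - q) 1) = _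
  rw [Module.finrank_self, Nat.cast_one, inv_one, one_mul]
  have hm : (q.den : ℚ) ≠ 0 := by exact_mod_cast q.den_nz
  have e1 : (q.den : ℚ)⁻¹ * q.num = q := by rw [inv_mul_eq_div, Rat.num_div_den]
  have e2 : (q.den : ℚ)⁻¹ * ((q.den : ℚ) - q.num) = 1 - q := by
    rw [mul_sub, inv_mul_cancel₀ hm, inv_mul_eq_div, Rat.num_div_den]
  have e3 : (q.den : ℚ)⁻¹ * q.den = 1 := inv_mul_cancel₀ hm
  have key : radicalNorm q (1 - q) 1 = radicalNorm (q.num : ℚ) ((q.den : ℚ) - q.num) (q.den : ℚ) := by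
    unfold radicalNorm
    rw [← badPrimes_mul_left (inv_ne_zero hm) (q.num : ℚ) ((q.den : ℚ) - q.num) (q.den : ℚ),
      e1, e2, e3]
  rw [key]

/-- The height of a `ℚ`-point: `ht(q) = log max(|n|, m)` for `q = n/m` in lowest terms
(Mathlib `Rat.logHeight₁_eq_log_max`). [cite: MochizukiGenEll2010, Def 1.2 (i) p.5] -/
theorem ht_ratPoint_eq (q : ℚ) : (ratPoint q).ht = Real.log (max q.num.natAbs q.den : ℕ) := by
  change ((Module.finrank ℚ ℚ : ℕ) : ℝ)⁻¹ * Height.logHeight₁ q = _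
  rw [Module.finrank_self, Nat.cast_one, inv_one, one_mul, Rat.logHeight₁_eq_log_max]

/-- **Every `ℚ`-point `q ≠ 0, 1` of `ℙ¹ ∖ {0,1,∞}` comes from an abc triple**: with `q = n/m` in
lowest terms, the naturals `|n|, m, |m − n|` form (in a suitable order) an abc triple `(a, b, c)`,
`log-cond(q) = log rad(abc)` and `ht(q) ≤ log c`. [cite: MochizukiGenEll2010, Def 1.5 (iv) p.8] -/
theorem exists_triple_of_ratPoint (q : ℚ) (h0 : q ≠ 0) (h1 : q ≠ 1) :
    ∃ a b c : ℕ, IsABCTriple a b c ∧ (ratPoint q).logCond = Real.log (rad a b c) ∧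
      (ratPoint q).ht ≤ Real.log c := by
  have hred : q.num.natAbs.Coprime q.den := q.reduced
  have hn0 : q.num ≠ 0 := Rat.num_ne_zero.mpr h0
  have hm0 : 0 < q.den := q.pos
  have hnm : q.num ≠ q.den := by
    intro h
    apply h1
    rw [← Rat.num_div_den q, h, Int.cast_natCast]
    exact div_self (by exact_mod_cast q.den_nz)
  rw [logCond_ratPoint_eq, ht_ratPoint_eq]
  set n : ℤ := q.num with hn
  set m : ℕ := q.den with hm
  set a : ℕ := n.natAbs with ha
  have ha0 : 0 < a := Int.natAbs_pos.mpr hn0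
  rcases lt_trichotomy n 0 with hneg | hzero | hpos
  · -- Case `n < 0`: the triple `(a, m, a + m)`
    have hx : (n : ℚ) = -(a : ℚ) := by
      have : n = -(a : ℤ) := by omega
      exact_mod_cast this
    have hy : (m : ℚ) - n = ((a + m : ℕ) : ℚ) := by rw [hx]; push_cast; ring
    refine ⟨a, m, a + m, ⟨ha0, hm0, rfl, hred⟩, ?_, ?_⟩
    · rw [hy, hx]
      unfold radicalNorm
      rw [badPrimes_neg₁, badPrimes_swap₂₃]
      exact congrArg _ (by
        have := UniformABCConjecture.radicalNorm_natCast_eq_rad (a := a) (b := m) (c := a + m) ⟨ha0, hm0, rfl, hred⟩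
        unfold radicalNorm at this
        exact_mod_cast this)
    · exact Real.log_le_log (by exact_mod_cast Nat.lt_of_lt_of_le ha0 (le_max_left _ _))
        (by exact_mod_cast max_le (Nat.le_add_right a m) (Nat.le_add_left m a))
  · exact absurd hzero hn0
  · have hna : n = (a : ℤ) := by omega
    have hx : (n : ℚ) = (a : ℚ) := by exact_mod_cast hna
    rcases lt_or_gt_of_ne hnm with hlt | hgt
    · -- Case `0 < n < m`: the triple `(a, m - a, m)`
      have ham : a < m := by omega
      have hy : (m : ℚ) - n = ((m - a : ℕ) : ℚ) := by
        rw [hx, Nat.cast_sub ham.le]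
      have hcop : Nat.Coprime a (m - a) := (Nat.coprime_sub_self_right ham.le).mpr hred
      refine ⟨a, m - a, m, ⟨ha0, by omega, by omega, hcop⟩, ?_, ?_⟩
      · rw [hy, hx]
        exact congrArg _ (by exact_mod_cast UniformABCConjecture.radicalNorm_natCast_eq_rad ⟨ha0, by omega, by omega, hcop⟩)
      · exact Real.log_le_log (by exact_mod_cast Nat.lt_of_lt_of_le ha0 (le_max_left _ _))
          (by exact_mod_cast max_le ham.le le_rfl)
    · -- Case `n > m`: the triple `(m, a - m, a)`
      have hma : m < a := by omega
      have hy : (m : ℚ) - n = -((a - m : ℕ) : ℚ) := by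
        rw [hx, Nat.cast_sub hma.le]; ring
      have hcop : Nat.Coprime m (a - m) := (Nat.coprime_sub_self_right hma.le).mpr hred.symm
      refine ⟨m, a - m, a, ⟨hm0, by omega, by omega, hcop⟩, ?_, ?_⟩
      · rw [hy, hx]
        unfold radicalNorm
        rw [badPrimes_neg₂, badPrimes_swap₁₃]
        exact congrArg _ (by
          have := UniformABCConjecture.radicalNorm_natCast_eq_rad (a := m) (b := a - m) (c := a) ⟨hm0, by omega, by omega, hcop⟩
          unfold radicalNorm at this
          exact_mod_cast this)
      · exact Real.log_le_log (by exact_mod_cast Nat.lt_of_lt_of_le ha0 (le_max_left _ _))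
          (by exact_mod_cast max_le le_rfl hma.le)

end RatValues

/-! ## Degree-one presentations are rational points; the converse bridge -/

/-- A presented point of `U_P(Q̄)^{≤ 1}` is, up to an isomorphism of presentations, a `ℚ`-point
`q ≠ 0, 1` with the same height, log-different and log-conductor (`[F:ℚ] = 1` forces `F ≃ ℚ`;
presentation-independence from `GenEllProjLineInvariance.lean`). [cite: MochizukiGenEll2010, Ex 1.3 (i) p.5] -/
theorem exists_ratPoint_of_mem_UPle_one {P : NFPoint} (hP : P ∈ UPle 1) :
    ∃ q : ℚ, q ≠ 0 ∧ q ≠ 1 ∧ (ratPoint q).ht = P.ht ∧ (ratPoint q).logDiff = P.logDiff ∧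
      (ratPoint q).logCond = P.logCond := by
  obtain ⟨⟨hU, -⟩, hdeg⟩ := hP
  have h1 : Module.finrank ℚ P.F = 1 := le_antisymm hdeg P.degree_pos
  have hsurj : Function.Surjective (algebraMap ℚ P.F) := by
    intro w
    obtain ⟨c, hc⟩ := (finrank_eq_one_iff_of_nonzero' (1 : P.F) one_ne_zero).mp h1 w
    exact ⟨c, by rw [Algebra.algebraMap_eq_smul_one, hc]⟩
  let e : ℚ ≃+* P.F :=
    RingEquiv.ofBijective (algebraMap ℚ P.F) ⟨(algebraMap ℚ P.F).injective, hsurj⟩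
  set q : ℚ := e.symm P.x with hq
  have hx : e q = P.x := e.apply_symm_apply P.x
  have hq0 : q ≠ 0 := by
    intro h; apply hU.1; rw [← hx, h, map_zero]
  have hq1 : q ≠ 1 := by
    intro h; apply hU.2; rw [← hx, h, map_one]
  exact ⟨q, hq0, hq1, NFPoint.ht_eq_of_ringEquiv (P := ratPoint q) (Q := P) e hx,
    NFPoint.logDiff_eq_of_ringEquiv (P := ratPoint q) (Q := P) e,
    NFPoint.logCond_eq_of_ringEquiv (P := ratPoint q) (Q := P) e hx⟩

/-- **abc ⟹ (i)|_{ℙ¹} at `d = 1`**: the abc inequality `c < C_ε · rad(abc)^{1+ε}` for all abc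
triples implies, for every `ε > 0`, `ht_{ω_P(C)} ≲ (1+ε)(log-diff_P + log-cond_C)` on `U_P(Q̄)^{≤1}`
(with constant `log C_ε`). PROVED. [cite: MochizukiGenEll2010, Thm 2.1 p.11] -/
theorem vojtaIneq_one_of_abc
    (habc : ∀ ε : ℝ, 0 < ε → ∃ C : ℝ, 0 < C ∧
      ∀ a b c : ℕ, IsABCTriple a b c → (c : ℝ) < C * ((rad a b c : ℕ) : ℝ) ^ (1 + ε))
    (ε : ℝ) (hε : 0 < ε) : VojtaIneq Set.univ 1 ε := by
  obtain ⟨C, hC, h⟩ := habc ε hε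
  refine ⟨Real.log C, fun P hP => ?_⟩
  obtain ⟨q, hq0, hq1, hht, hdiff, hcond⟩ := exists_ratPoint_of_mem_UPle_one hP.2
  obtain ⟨a, b, c, habc', hcondq, hhtq⟩ := exists_triple_of_ratPoint q hq0 hq1
  change P.ht - (1 + ε) * (P.logDiff + P.logCond) ≤ Real.log C
  rw [← hht, ← hdiff, ← hcond, logDiff_ratPoint, zero_add, hcondq]
  have hlt := h a b c habc'
  have hc0 : (0 : ℝ) < c := by
    have : 0 < c := by obtain ⟨ha, -, hsum, -⟩ := habc'; omega
    exact_mod_cast this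
  have hr0 : (0 : ℝ) < (rad a b c : ℝ) := by
    have : 0 < rad a b c := by
      rw [rad_def]; exact Nat.pos_of_ne_zero UniqueFactorizationMonoid.radical_ne_zero
    exact_mod_cast this
  have hlog : Real.log c < Real.log C + (1 + ε) * Real.log (rad a b c) := by
    have := Real.log_lt_log hc0 hlt
    rw [Real.log_mul hC.ne' (Real.rpow_pos_of_pos hr0 _).ne', Real.log_rpow hr0] at this
    linarith
  linarith [hhtq]

/-- **Faithfulness certificate**: statement (i) of [GenEll] Thm. 2.1 for `(ℙ¹_ℚ, [0]+[1]+[∞])` at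
`d = 1`, as typed here, is EQUIVALENT to the abc inequality of Masser–Oesterlé (the displayed
sentence of the summit statement `ABC`). PROVED. [cite: MochizukiGenEll2010, Thm 2.1 p.11] -/
theorem vojtaP1Deg_one_iff_abc :
    VojtaP1Deg 1 ↔
      ∀ ε : ℝ, 0 < ε → ∃ C : ℝ, 0 < C ∧
        ∀ a b c : ℕ, IsABCTriple a b c → (c : ℝ) < C * ((rad a b c : ℕ) : ℝ) ^ (1 + ε) :=
  ⟨fun h => abc_of_vojtaIneq_one h, fun h ε hε => vojtaIneq_one_of_abc h ε hε⟩

end Literature.NumberTheory.DiophantineGeometry.GenEll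

end
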